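import Mathlib.LinearAlgebra.Matrix.PosDef
import Mathlib.LinearAlgebra.Matrix.Trace
import Mathlib.Order.ConditionallyCompleteLattice.Basic
import Literature.Computation.Certificates.SemidefiniteRigorousBounds
import HarnessLib

/-!
# Ventures/CertifiedQuantumChemistry — Rows/ExactEnclosureCertificate.lean: the THEOREM behind an
# exact ENCLOSURE `v_lo ≤ v(P) ≤ v_hi` of a block-SDP value (the `rdmB-exact-enclosure/1` checker of
# record) and the ANCHOR-MIXING lemma behind its exact primal half

HONEST FRAMING (verbatim): certified bounds for a stated model Hamiltonian in a stated basis; not a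
claim about the real molecule beyond that model. The programmes this file speaks about are block
semidefinite programmes written in the fleet's `certsdp-problem/0` format; the `X_∞` programmes of the
cell's structure ladder are AUXILIARY LIMIT PROGRAMMES of a relaxation, not model Hamiltonians, and
nothing in this file asserts a value, a row or a claim node about anything.

Seat rdm-B (gen 30), zero compute; theorems only (no `def`, no claim node, no model). Companion of
`Rows/KernelFacialReduction.lean` (gen 29). It types, once and for all indices, WHAT A `PASS` OF THE
CELL'S EXACT ENCLOSURE CHECKER MEANS (`code/qchem_rdm_b/check_enclosure.py`, single file, stdlib,
the checker of record of RULE ENC-6 … ENC-12 and of the NARROW-12 re-deposit `pub-qchem-rdmb/ab-files/v57/`):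

**The programme** (`certsdp-problem/0`, no `le` rows, `norm 0`): real variables `y : V → ℝ` with a
UNIT variable `y u = 1` (index `0` of the file); objective `Σ_v c_v y_v + c₀` (MINIMISED); equality rows
`Σ_v A_{e,v} y_v = b_e`; boxes `|y_v| ≤ ρ_v` on a subset `boxed` of the variables (the file's `bounds`;
unbounded variables carry none); PSD blocks `B_k(y) = Σ_v y_v F_{k,v} ⪰ 0` (real symmetric data).

* §1 `ExactEnclosure.dual_lower_bound` — **verdict (b) DUAL**: block matrices `Z_k ⪰ 0`, row
  multipliers `λ_e` (free), box multipliers `μ⁺_v, μ⁻_v ≥ 0` living only on boxed variables, and EXACT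
  STATIONARITY at every variable `v ≠ u`,
  `c_v = Σ_e λ_e A_{e,v} + Σ_k ⟨Z_k, F_{k,v}⟩ + μ⁺_v − μ⁻_v`,
  give, for EVERY feasible `y`,
  `c·y + c₀ ≥ v_lo := c_u + c₀ + Σ_e λ_e b_e − (Σ_e λ_e A_{e,u} + Σ_k ⟨Z_k, F_{k,u}⟩) − Σ_{v boxed} ρ_v (μ⁺_v + μ⁻_v)`
  — letter for letter the `dual bound` line of the checker. (Weak duality; the one inequality used is
  `⟨Z, B⟩ = tr (Z B) ≥ 0` for `Z, B ⪰ 0`, imported from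
  `Literature/Computation/Certificates/SemidefiniteRigorousBounds.lean`, whose
  `JanssonChaykinKeil.lmiForm_bound` is the same mechanism with inexact residuals and a-priori bounds;
  here the residuals are EXACTLY the box multipliers, so no a-priori bound on an unboxed variable is
  needed — which is why the checker insists on exact stationarity there.)
* §2 `ExactEnclosure.primal_upper_bound` / `le_value_of_forall` / `enclosure` — **verdict (a) PRIMAL**
  (a feasible `ŷ` with `c·ŷ + c₀ = v_hi` bounds the value `v(P) := inf {c·y + c₀ : y feasible}` from
  above) and the **ENCLOSURE** `v_lo ≤ v(P) ≤ v_hi`, `0 ≤ width`, stated for an arbitrary feasibility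
  predicate (pure order theory: the feasible set is nonempty by (a) and its objective bounded below by
  (b)); `enclosure_certsdp0` assembles (a) + (b) for the programme above.
* §3 `ExactEnclosure.posSemidef_mix_of_margins` and `feasible_mix_of_margins` — the **ANCHOR-MIXING
  LEMMA** behind the exact primal constructor (`primal_sym.py` / `primal_tau.py`, METHOD NOTE
  X∞-E/NARROW §1): if `y` satisfies the unit / equality / box constraints exactly but its blocks are
  only NEARLY positive semidefinite, `B_k(y) + ε_k·1 ⪰ 0`, and an ANCHOR `a` is feasible with margins
  `B_k(a) − μ_k·1 ⪰ 0` (a Slater point), then for `0 ≤ τ ≤ 1` with `(1 − τ) ε_k ≤ τ μ_k` (all `k`) the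
  mixture `y_τ = (1 − τ) y + τ a` is FEASIBLE, and its objective is
  `c·y_τ + c₀ = (c·y + c₀) + τ · ((c·a + c₀) − (c·y + c₀))` — the "lever arm": the exact upper half
  costs `τ` times the anchor's objective excess, so its width is governed by the ACCURACY `ε` of the
  float point (`τ ≈ ε/μ`), which is the diagnosis of the METHOD NOTE.

Arithmetic remark (words, not Lean): the checker computes in `ℚ` or in the ordered field `ℚ(√2) ⊂ ℝ`
(`[p, q] = p + q√2`) without rounding; every identity and every sign it verifies there holds verbatim
in `ℝ`, where the theorems below apply (PSD by exact `LDLᵀ` ⇒ `PosSemidef` over `ℝ`).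
Everything is PROVED (0 sorry). References (docstring-only, no CITED-FACTS entry): weak duality for
semidefinite programmes in inequality form, e.g. L. Vandenberghe, S. Boyd, SIAM Rev. 38 (1996) 49, §3;
C. Jansson, D. Chaykin, C. Keil, SIAM J. Numer. Anal. 46 (2007/08) 180 (rigorous a-posteriori bounds);
the anchor-mixing step is the standard interior-point "convex combination with a strictly feasible
point" (folklore).
-/

namespace Summit.Ventures.CertifiedQuantumChemistry

open Matrix Finset
open scoped BigOperators

namespace ExactEnclosure

/-! ### §1 Verdict (b): the exact dual bound (weak duality with box multipliers) -/

section Dual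

variable {V : Type*} [Fintype V] [DecidableEq V] {E : Type*} [Fintype E]
  {K : Type*} [Fintype K] {σ : K → Type*} [∀ k, Fintype (σ k)]

omit [DecidableEq V] in
/-- Bookkeeping: pairing the COLUMN IMAGE `Σ_e λ_e A_{e,v} + Σ_k ⟨Z_k, F_{k,v}⟩` of the multipliers
with a row-feasible `y` gives `Σ_e λ_e b_e + Σ_k ⟨Z_k, B_k(y)⟩`. [folklore] -/
theorem sum_colImage_mul_eq (A : E → V → ℝ) (b : E → ℝ) (F : ∀ k, V → Matrix (σ k) (σ k) ℝ)
    {y : V → ℝ} (hrows : ∀ e, ∑ v, A e v * y v = b e)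
    (lam : E → ℝ) (Z : ∀ k, Matrix (σ k) (σ k) ℝ) :
    ∑ v, (∑ e, lam e * A e v + ∑ k, trace (Z k * F k v)) * y v =
      ∑ e, lam e * b e + ∑ k, trace (Z k * ∑ v, y v • F k v) := by
  have hE : ∑ v, (∑ e, lam e * A e v) * y v = ∑ e, lam e * b e := by
    simp_rw [Finset.sum_mul]
    rw [Finset.sum_comm]
    refine Finset.sum_congr rfl fun e _ => ?_
    rw [← hrows e, Finset.mul_sum]
    exact Finset.sum_congr rfl fun v _ => by ring
  have hK : ∑ v, (∑ k, trace (Z k * F k v)) * y v = ∑ k, trace (Z k * ∑ v, y v • F k v) := by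
    simp_rw [Finset.sum_mul]
    rw [Finset.sum_comm]
    refine Finset.sum_congr rfl fun k _ => ?_
    rw [Finset.mul_sum, Matrix.trace_sum]
    refine Finset.sum_congr rfl fun v _ => ?_
    rw [Matrix.mul_smul, Matrix.trace_smul, smul_eq_mul, mul_comm]
  simp_rw [add_mul]
  rw [Finset.sum_add_distrib, hE, hK]

/-- **VERDICT (b) DUAL of the exact enclosure checker** (`check_enclosure.py`, format
`rdmB-exact-enclosure/1` against `certsdp-problem/0`). Programme: unit variable `y u = 1`, rows
`Σ_v A_{e,v} y_v = b_e`, boxes `|y_v| ≤ ρ_v` for `v ∈ boxed`, blocks `Σ_v y_v F_{k,v} ⪰ 0`, objective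
`Σ_v c_v y_v + c₀`. Certificate: `Z_k ⪰ 0`, `λ_e`, box multipliers `μ⁺, μ⁻ ≥ 0` vanishing off `boxed`,
exact stationarity at every `v ≠ u`. Conclusion: every feasible `y` has objective at least
`v_lo = c_u + c₀ + λ·b − (Σ_e λ_e A_{e,u} + Σ_k ⟨Z_k, F_{k,u}⟩) − Σ_{v ∈ boxed} ρ_v (μ⁺_v + μ⁻_v)`.
[weak duality; folklore] -/
theorem dual_lower_bound (c : V → ℝ) (c0 : ℝ) (u : V) (A : E → V → ℝ) (b : E → ℝ)
    (F : ∀ k, V → Matrix (σ k) (σ k) ℝ) (boxed : Finset V) (ρ : V → ℝ)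
    -- a feasible point
    {y : V → ℝ} (hyu : y u = 1) (hrows : ∀ e, ∑ v, A e v * y v = b e)
    (hbox : ∀ v ∈ boxed, |y v| ≤ ρ v) (hpsd : ∀ k, (∑ v, y v • F k v).PosSemidef)
    -- the certificate
    (lam : E → ℝ) (Z : ∀ k, Matrix (σ k) (σ k) ℝ) (hZ : ∀ k, (Z k).PosSemidef)
    (mp mm : V → ℝ) (hmp : ∀ v, 0 ≤ mp v) (hmm : ∀ v, 0 ≤ mm v)
    (hoff : ∀ v, v ∉ boxed → mp v = 0 ∧ mm v = 0)
    (hstat : ∀ v, v ≠ u →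
      c v = ∑ e, lam e * A e v + ∑ k, trace (Z k * F k v) + mp v - mm v)
    (vlo : ℝ)
    (hvlo : vlo = c u + c0 + ∑ e, lam e * b e
      - (∑ e, lam e * A e u + ∑ k, trace (Z k * F k u)) - ∑ v ∈ boxed, ρ v * (mp v + mm v)) :
    vlo ≤ ∑ v, c v * y v + c0 := by
  -- the column image of the multipliers, kept opaque
  obtain ⟨S, hS⟩ : ∃ S : V → ℝ, ∀ v, S v = ∑ e, lam e * A e v + ∑ k, trace (Z k * F k v) :=
    ⟨_, fun v => rfl⟩
  have hcol : ∑ v, S v * y v = ∑ e, lam e * b e + ∑ k, trace (Z k * ∑ v, y v • F k v) := by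
    simp_rw [hS]
    exact sum_colImage_mul_eq A b F hrows lam Z
  have hstat' : ∀ v, v ≠ u → c v = S v + (mp v - mm v) := by
    intro v hv; rw [hS, hstat v hv]; ring
  -- split off the unit variable
  have hsplit : ∑ v, c v * y v = c u + ∑ v ∈ univ.erase u, c v * y v := by
    rw [← Finset.add_sum_erase _ _ (Finset.mem_univ u), hyu, mul_one]
  have hsplitS : ∑ v ∈ univ.erase u, S v * y v = ∑ v, S v * y v - S u := by
    rw [← Finset.add_sum_erase _ (fun v => S v * y v) (Finset.mem_univ u), hyu, mul_one]
    ring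
  -- stationarity on the variables `v ≠ u`
  have herase : ∑ v ∈ univ.erase u, c v * y v =
      ∑ v ∈ univ.erase u, S v * y v + ∑ v ∈ univ.erase u, (mp v - mm v) * y v := by
    rw [← Finset.sum_add_distrib]
    refine Finset.sum_congr rfl fun v hv => ?_
    rw [hstat' v (Finset.ne_of_mem_erase hv)]
    ring
  -- the block pairings are nonnegative (both factors PSD)
  have hblocks : 0 ≤ ∑ k, trace (Z k * ∑ v, y v • F k v) :=
    Finset.sum_nonneg fun k _ =>
      Literature.Computation.Certificates.trace_mul_nonneg_of_posSemidef (hZ k) (hpsd k)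
  -- the box multipliers cost at most `ρ_v (μ⁺_v + μ⁻_v)` each
  have hpt : ∀ v, -(if v ∈ boxed then ρ v * (mp v + mm v) else 0) ≤ (mp v - mm v) * y v := by
    intro v
    split_ifs with hv
    · have h1 := hbox v hv
      have hy1 : -ρ v ≤ y v := by linarith [neg_abs_le (y v)]
      have hy2 : y v ≤ ρ v := le_trans (le_abs_self _) h1
      nlinarith [mul_le_mul_of_nonneg_left hy1 (hmp v), mul_le_mul_of_nonneg_left hy2 (hmm v)]
    · obtain ⟨h4, h5⟩ := hoff v hv
      rw [h4, h5]; simp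
  have hg : ∀ v, 0 ≤ (if v ∈ boxed then ρ v * (mp v + mm v) else 0) := by
    intro v
    split_ifs with hv
    · exact mul_nonneg (le_trans (abs_nonneg _) (hbox v hv)) (add_nonneg (hmp v) (hmm v))
    · exact le_refl _
  have hboxes : -(∑ v ∈ boxed, ρ v * (mp v + mm v)) ≤
      ∑ v ∈ univ.erase u, (mp v - mm v) * y v := by
    calc -(∑ v ∈ boxed, ρ v * (mp v + mm v))
        = -(∑ v, if v ∈ boxed then ρ v * (mp v + mm v) else 0) := by
          rw [Fintype.sum_ite_mem]
      _ ≤ -(∑ v ∈ univ.erase u, if v ∈ boxed then ρ v * (mp v + mm v) else 0) := by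
          apply neg_le_neg
          exact Finset.sum_le_sum_of_subset_of_nonneg (Finset.subset_univ _) fun v _ _ => hg v
      _ = ∑ v ∈ univ.erase u, -(if v ∈ boxed then ρ v * (mp v + mm v) else 0) := by
          rw [Finset.sum_neg_distrib]
      _ ≤ ∑ v ∈ univ.erase u, (mp v - mm v) * y v := Finset.sum_le_sum fun v _ => hpt v
  -- assemble
  rw [hvlo, hsplit, herase, hsplitS, hcol, hS u]
  linarith [hblocks, hboxes]

end Dual

/-! ### §2 Verdict (a) and the ENCLOSURE of the optimal value (order bookkeeping) -/

section Value

variable {Y : Type*}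

/-- **VERDICT (a) PRIMAL**: a feasible point `ŷ` bounds the optimal value
`v(P) = inf {obj y : y feasible}` from above, `v(P) ≤ obj ŷ` (the objective being bounded below on the
feasible set, e.g. by verdict (b)). [folklore] -/
theorem primal_upper_bound (Feas : Y → Prop) (obj : Y → ℝ) {yh : Y} (hyh : Feas yh)
    (hbdd : BddBelow {t : ℝ | ∃ y, Feas y ∧ t = obj y}) :
    sInf {t : ℝ | ∃ y, Feas y ∧ t = obj y} ≤ obj yh :=
  csInf_le hbdd ⟨yh, hyh, rfl⟩

/-- A uniform lower bound of the objective on a NONEMPTY feasible set bounds the optimal value from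
below. [folklore] -/
theorem le_value_of_forall (Feas : Y → Prop) (obj : Y → ℝ) {vlo : ℝ}
    (hlo : ∀ y, Feas y → vlo ≤ obj y) {yh : Y} (hyh : Feas yh) :
    vlo ≤ sInf {t : ℝ | ∃ y, Feas y ∧ t = obj y} :=
  le_csInf ⟨obj yh, yh, hyh, rfl⟩ (by rintro t ⟨y, hy, rfl⟩; exact hlo y hy)

/-- **ENCLOSURE**: verdict (b) (`v_lo ≤ obj y` for every feasible `y`) and verdict (a) (a feasible
`ŷ` with `obj ŷ = v_hi`) enclose the optimal value, `v_lo ≤ v(P) ≤ v_hi`, and the printed width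
`v_hi − v_lo` is nonnegative. [folklore] -/
theorem enclosure (Feas : Y → Prop) (obj : Y → ℝ) {vlo vhi : ℝ}
    (hlo : ∀ y, Feas y → vlo ≤ obj y) {yh : Y} (hyh : Feas yh) (hvhi : obj yh = vhi) :
    vlo ≤ sInf {t : ℝ | ∃ y, Feas y ∧ t = obj y} ∧
      sInf {t : ℝ | ∃ y, Feas y ∧ t = obj y} ≤ vhi ∧ 0 ≤ vhi - vlo := by
  have hbdd : BddBelow {t : ℝ | ∃ y, Feas y ∧ t = obj y} :=
    ⟨vlo, by rintro t ⟨y, hy, rfl⟩; exact hlo y hy⟩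
  refine ⟨le_value_of_forall Feas obj hlo hyh, ?_, ?_⟩
  · rw [← hvhi]
    exact primal_upper_bound Feas obj hyh hbdd
  · have := hlo yh hyh
    rw [hvhi] at this
    exact sub_nonneg.mpr this

end Value

section Assemble

variable {V : Type*} [Fintype V] [DecidableEq V] {E : Type*} [Fintype E]
  {K : Type*} [Fintype K] {σ : K → Type*} [∀ k, Fintype (σ k)]

/-- **THE CHECKER'S THEOREM** (`check_enclosure.py`, both halves PASS ⇒ `ENCLOSURE: PASS`): for the
`certsdp-problem/0` programme (unit variable, equality rows, boxes on `boxed`, PSD blocks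
`Σ_v y_v F_{k,v}`), a primal point `ŷ` passing verdict (a) with value `v_hi` and a dual certificate
passing verdict (b) with value `v_lo` give `v_lo ≤ v(P) ≤ v_hi` for the optimal value
`v(P) = inf {Σ_v c_v y_v + c₀ : y feasible}`, and `0 ≤ v_hi − v_lo`. [weak duality; folklore] -/
theorem enclosure_certsdp0 (c : V → ℝ) (c0 : ℝ) (u : V) (A : E → V → ℝ) (b : E → ℝ)
    (F : ∀ k, V → Matrix (σ k) (σ k) ℝ) (boxed : Finset V) (ρ : V → ℝ)
    -- verdict (a): the primal point
    {yh : V → ℝ} (hyu : yh u = 1) (hrows : ∀ e, ∑ v, A e v * yh v = b e)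
    (hbox : ∀ v ∈ boxed, |yh v| ≤ ρ v) (hpsd : ∀ k, (∑ v, yh v • F k v).PosSemidef)
    (vhi : ℝ) (hvhi : ∑ v, c v * yh v + c0 = vhi)
    -- verdict (b): the dual certificate
    (lam : E → ℝ) (Z : ∀ k, Matrix (σ k) (σ k) ℝ) (hZ : ∀ k, (Z k).PosSemidef)
    (mp mm : V → ℝ) (hmp : ∀ v, 0 ≤ mp v) (hmm : ∀ v, 0 ≤ mm v)
    (hoff : ∀ v, v ∉ boxed → mp v = 0 ∧ mm v = 0)
    (hstat : ∀ v, v ≠ u →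
      c v = ∑ e, lam e * A e v + ∑ k, trace (Z k * F k v) + mp v - mm v)
    (vlo : ℝ)
    (hvlo : vlo = c u + c0 + ∑ e, lam e * b e
      - (∑ e, lam e * A e u + ∑ k, trace (Z k * F k u)) - ∑ v ∈ boxed, ρ v * (mp v + mm v)) :
    vlo ≤ sInf {t : ℝ | ∃ y : V → ℝ, (y u = 1 ∧ (∀ e, ∑ v, A e v * y v = b e) ∧
        (∀ v ∈ boxed, |y v| ≤ ρ v) ∧ ∀ k, (∑ v, y v • F k v).PosSemidef) ∧
        t = ∑ v, c v * y v + c0} ∧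
      sInf {t : ℝ | ∃ y : V → ℝ, (y u = 1 ∧ (∀ e, ∑ v, A e v * y v = b e) ∧
        (∀ v ∈ boxed, |y v| ≤ ρ v) ∧ ∀ k, (∑ v, y v • F k v).PosSemidef) ∧
        t = ∑ v, c v * y v + c0} ≤ vhi ∧
      0 ≤ vhi - vlo :=
  enclosure
    (fun y : V → ℝ => y u = 1 ∧ (∀ e, ∑ v, A e v * y v = b e) ∧
      (∀ v ∈ boxed, |y v| ≤ ρ v) ∧ ∀ k, (∑ v, y v • F k v).PosSemidef)
    (fun y => ∑ v, c v * y v + c0)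
    (fun _ hy => dual_lower_bound c c0 u A b F boxed ρ hy.1 hy.2.1 hy.2.2.1 hy.2.2.2 lam Z hZ
      mp mm hmp hmm hoff hstat vlo hvlo)
    ⟨hyu, hrows, hbox, hpsd⟩ hvhi

end Assemble

/-! ### §3 The anchor-mixing lemma (exact primal half from a nearly feasible float point) -/

section Mix

variable {n : Type*} [DecidableEq n]

/-- **PSD BY MIXING WITH A MARGIN.** If `B + ε·1 ⪰ 0` (the eigenvalues of `B` are `≥ −ε`) and
`P − μ·1 ⪰ 0` (those of the anchor block `P` are `≥ μ`), then for `0 ≤ τ ≤ 1` with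
`(1 − τ) ε ≤ τ μ` the mixture `(1 − τ) B + τ P` is positive semidefinite: it equals the PSD combination
`(1 − τ)(B + ε·1) + τ (P − μ·1)` plus `(τ μ − (1 − τ) ε)·1 ⪰ 0`. [folklore] -/
theorem posSemidef_mix_of_margins {B P : Matrix n n ℝ} {ε μ τ : ℝ}
    (hB : (B + ε • (1 : Matrix n n ℝ)).PosSemidef) (hP : (P - μ • (1 : Matrix n n ℝ)).PosSemidef)
    (hτ0 : 0 ≤ τ) (hτ1 : τ ≤ 1) (hmargin : (1 - τ) * ε ≤ τ * μ) :
    ((1 - τ) • B + τ • P).PosSemidef := by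
  have h1 : ((1 - τ) • (B + ε • (1 : Matrix n n ℝ)) + τ • (P - μ • (1 : Matrix n n ℝ))).PosSemidef :=
    (hB.smul (sub_nonneg.mpr hτ1)).add (hP.smul hτ0)
  have h2 : ((τ * μ - (1 - τ) * ε) • (1 : Matrix n n ℝ)).PosSemidef :=
    Matrix.PosSemidef.one.smul (sub_nonneg.mpr hmargin)
  have h := h1.add h2
  have e : (1 - τ) • (B + ε • (1 : Matrix n n ℝ)) + τ • (P - μ • (1 : Matrix n n ℝ)) +
      (τ * μ - (1 - τ) * ε) • (1 : Matrix n n ℝ) = (1 - τ) • B + τ • P := by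
    module
  rwa [e] at h

variable {V : Type*} [Fintype V] {E : Type*} {m : Type*}

omit [Fintype V] in
/-- The unit variable survives mixing. [folklore] -/
theorem mix_unit {y a : V → ℝ} {u : V} (τ : ℝ) (hy : y u = 1) (ha : a u = 1) :
    (1 - τ) * y u + τ * a u = 1 := by
  rw [hy, ha]; ring

/-- Equality rows survive mixing (both points satisfy them). [folklore] -/
theorem mix_rows (A : E → V → ℝ) (b : E → ℝ) {y a : V → ℝ} (τ : ℝ)
    (hy : ∀ e, ∑ v, A e v * y v = b e) (ha : ∀ e, ∑ v, A e v * a v = b e) (e : E) :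
    ∑ v, A e v * ((1 - τ) * y v + τ * a v) = b e := by
  have h : ∑ v, A e v * ((1 - τ) * y v + τ * a v) =
      (1 - τ) * ∑ v, A e v * y v + τ * ∑ v, A e v * a v := by
    rw [Finset.mul_sum, Finset.mul_sum, ← Finset.sum_add_distrib]
    exact Finset.sum_congr rfl fun v _ => by ring
  rw [h, hy e, ha e]; ring

/-- Boxes survive mixing (`|·| ≤ ρ` is convex). [folklore] -/
theorem abs_mix_le {s t ρ τ : ℝ} (hs : |s| ≤ ρ) (ht : |t| ≤ ρ) (hτ0 : 0 ≤ τ) (hτ1 : τ ≤ 1) :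
    |(1 - τ) * s + τ * t| ≤ ρ := by
  calc |(1 - τ) * s + τ * t| ≤ |(1 - τ) * s| + |τ * t| := abs_add_le _ _
    _ = (1 - τ) * |s| + τ * |t| := by
        rw [abs_mul, abs_mul, abs_of_nonneg (sub_nonneg.mpr hτ1), abs_of_nonneg hτ0]
    _ ≤ (1 - τ) * ρ + τ * ρ := add_le_add (mul_le_mul_of_nonneg_left hs (sub_nonneg.mpr hτ1))
        (mul_le_mul_of_nonneg_left ht hτ0)
    _ = ρ := by ring

/-- Block maps are affine: `B(y_τ) = (1 − τ) B(y) + τ B(a)`. [folklore] -/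
theorem mix_blocks (F : V → Matrix m m ℝ) (y a : V → ℝ) (τ : ℝ) :
    ∑ v, ((1 - τ) * y v + τ * a v) • F v = (1 - τ) • ∑ v, y v • F v + τ • ∑ v, a v • F v := by
  rw [Finset.smul_sum, Finset.smul_sum, ← Finset.sum_add_distrib]
  refine Finset.sum_congr rfl fun v _ => ?_
  rw [add_smul, smul_smul, smul_smul]

/-- THE LEVER ARM: the objective of the mixture is `obj y + τ · (obj a − obj y)`. [folklore] -/
theorem mix_objective (c : V → ℝ) (c0 : ℝ) (y a : V → ℝ) (τ : ℝ) :
    ∑ v, c v * ((1 - τ) * y v + τ * a v) + c0 =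
      (∑ v, c v * y v + c0) + τ * ((∑ v, c v * a v + c0) - (∑ v, c v * y v + c0)) := by
  have h : ∑ v, c v * ((1 - τ) * y v + τ * a v) =
      (1 - τ) * ∑ v, c v * y v + τ * ∑ v, c v * a v := by
    rw [Finset.mul_sum, Finset.mul_sum, ← Finset.sum_add_distrib]
    exact Finset.sum_congr rfl fun v _ => by ring
  rw [h]; ring

variable {K : Type*} {σ : K → Type*} [∀ k, DecidableEq (σ k)]

/-- **ANCHOR MIXING (the exact primal constructor).** Programme as in §1. Let `y` satisfy the unit,
row and box constraints EXACTLY with nearly-PSD blocks `B_k(y) + ε_k·1 ⪰ 0`, and let the anchor `a`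
be feasible with margins `B_k(a) − μ_k·1 ⪰ 0`. For `0 ≤ τ ≤ 1` with `(1 − τ) ε_k ≤ τ μ_k` for every
block, the mixture `y_τ = (1 − τ) y + τ a` is FEASIBLE (so it passes verdict (a)), and its objective is
`(c·y + c₀) + τ·((c·a + c₀) − (c·y + c₀))`. In the cell's use `y` is the (row-projected) float optimum,
`a` the physical anchor, `τ` the least dyadic fraction passing the exact `LDLᵀ` screens. [folklore] -/
theorem feasible_mix_of_margins (c : V → ℝ) (c0 : ℝ) (u : V) (A : E → V → ℝ) (b : E → ℝ)
    (F : ∀ k, V → Matrix (σ k) (σ k) ℝ) (boxed : Finset V) (ρ : V → ℝ)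
    -- the point to be repaired
    {y : V → ℝ} (hyu : y u = 1) (hrows : ∀ e, ∑ v, A e v * y v = b e)
    (hbox : ∀ v ∈ boxed, |y v| ≤ ρ v) (ε : K → ℝ)
    (hpsdε : ∀ k, (∑ v, y v • F k v + ε k • (1 : Matrix (σ k) (σ k) ℝ)).PosSemidef)
    -- the anchor
    {a : V → ℝ} (hau : a u = 1) (harows : ∀ e, ∑ v, A e v * a v = b e)
    (habox : ∀ v ∈ boxed, |a v| ≤ ρ v) (μ : K → ℝ)
    (hpsdμ : ∀ k, (∑ v, a v • F k v - μ k • (1 : Matrix (σ k) (σ k) ℝ)).PosSemidef)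
    -- the mixing parameter
    {τ : ℝ} (hτ0 : 0 ≤ τ) (hτ1 : τ ≤ 1) (hmargin : ∀ k, (1 - τ) * ε k ≤ τ * μ k) :
    ((fun v => (1 - τ) * y v + τ * a v) u = 1 ∧
      (∀ e, ∑ v, A e v * ((1 - τ) * y v + τ * a v) = b e) ∧
      (∀ v ∈ boxed, |(1 - τ) * y v + τ * a v| ≤ ρ v) ∧
      (∀ k, (∑ v, ((1 - τ) * y v + τ * a v) • F k v).PosSemidef)) ∧
    ∑ v, c v * ((1 - τ) * y v + τ * a v) + c0 =
      (∑ v, c v * y v + c0) + τ * ((∑ v, c v * a v + c0) - (∑ v, c v * y v + c0)) := by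
  refine ⟨⟨mix_unit τ hyu hau, mix_rows A b τ hrows harows,
    fun v hv => abs_mix_le (hbox v hv) (habox v hv) hτ0 hτ1, fun k => ?_⟩,
    mix_objective c c0 y a τ⟩
  rw [mix_blocks (F k) y a τ]
  exact posSemidef_mix_of_margins (hpsdε k) (hpsdμ k) hτ0 hτ1 (hmargin k)

/-- Consequence for the enclosure: with the mixture of `feasible_mix_of_margins` as the primal point,
`v(P) ≤ (c·y + c₀) + τ·((c·a + c₀) − (c·y + c₀))` whenever the objective is bounded below on the
feasible set (verdict (b)). [folklore] -/
theorem value_le_mix_objective [DecidableEq V] [Fintype E] [Fintype K]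
    (c : V → ℝ) (c0 : ℝ) (u : V) (A : E → V → ℝ) (b : E → ℝ)
    (F : ∀ k, V → Matrix (σ k) (σ k) ℝ) (boxed : Finset V) (ρ : V → ℝ)
    {y : V → ℝ} (hyu : y u = 1) (hrows : ∀ e, ∑ v, A e v * y v = b e)
    (hbox : ∀ v ∈ boxed, |y v| ≤ ρ v) (ε : K → ℝ)
    (hpsdε : ∀ k, (∑ v, y v • F k v + ε k • (1 : Matrix (σ k) (σ k) ℝ)).PosSemidef)
    {a : V → ℝ} (hau : a u = 1) (harows : ∀ e, ∑ v, A e v * a v = b e)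
    (habox : ∀ v ∈ boxed, |a v| ≤ ρ v) (μ : K → ℝ)
    (hpsdμ : ∀ k, (∑ v, a v • F k v - μ k • (1 : Matrix (σ k) (σ k) ℝ)).PosSemidef)
    {τ : ℝ} (hτ0 : 0 ≤ τ) (hτ1 : τ ≤ 1) (hmargin : ∀ k, (1 - τ) * ε k ≤ τ * μ k)
    {vlo : ℝ}
    (hlo : ∀ z : V → ℝ, (z u = 1 ∧ (∀ e, ∑ v, A e v * z v = b e) ∧
        (∀ v ∈ boxed, |z v| ≤ ρ v) ∧ ∀ k, (∑ v, z v • F k v).PosSemidef) →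
        vlo ≤ ∑ v, c v * z v + c0) :
    sInf {t : ℝ | ∃ z : V → ℝ, (z u = 1 ∧ (∀ e, ∑ v, A e v * z v = b e) ∧
        (∀ v ∈ boxed, |z v| ≤ ρ v) ∧ ∀ k, (∑ v, z v • F k v).PosSemidef) ∧
        t = ∑ v, c v * z v + c0} ≤
      (∑ v, c v * y v + c0) + τ * ((∑ v, c v * a v + c0) - (∑ v, c v * y v + c0)) := by
  obtain ⟨hfeas, hobj⟩ := feasible_mix_of_margins c c0 u A b F boxed ρ hyu hrows hbox ε hpsdε hau
    harows habox μ hpsdμ hτ0 hτ1 hmargin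
  have h := (enclosure
    (fun z : V → ℝ => z u = 1 ∧ (∀ e, ∑ v, A e v * z v = b e) ∧
      (∀ v ∈ boxed, |z v| ≤ ρ v) ∧ ∀ k, (∑ v, z v • F k v).PosSemidef)
    (fun z => ∑ v, c v * z v + c0) hlo hfeas hobj).2.1
  exact h

end Mix

end ExactEnclosure

end Summit.Ventures.CertifiedQuantumChemistry
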